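import Summits.NavierStokesRegularity.NavierStokesRegularity.Theorems.NoOverheating.Negative.ExcludedStrataCensusV10
import Summits.NavierStokesRegularity.NavierStokesRegularity.Theorems.NoOverheating.Negative.AsymptoticSelfSimilarityWindowsExcluded

/-!
# KJ-63b — CENSUS v11 of the excluded strata of route `AngularGalerkinLadder`'s window sequences
# ((S0)–(S22) of `excludedStrata_windowSequences_v10` + (S23) asymptotic plain self-similarity at a
# fine scale ratio — the DSS defect at fine scales cannot tend to zero along the ladder)

Refuter lineage, Negative lane of crux K2 `NoOverheating` (supports, does not decide).  Pure
assembly — this file proves NOTHING new: it folds kernel row KJ-63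
(`AsymptoticSelfSimilarityWindowsExcluded`) into the census statement of record,
`excludedStrata_windowSequences_v11`, "what an admissible window sequence of K2 can NOT be".  One
new binder `lam₂ = λ₁(C₀) > 1` (Chae–Wolf's fine-range threshold, as `lam₁` of (S5)):

* (S23) for some FIXED fine scale `λ ∈ (1, lam₂)`, the plain-DSS defect tends to zero pointwise on
  the past, `λ uₙ(λ² t, λ x) − uₙ(t, x) → 0` (`t < 0`, `x ∈ ℝ³`): the cut-off ladder limit is
  `λ`-DSS by the JOINT space–time convergence on compact cylinders (`exists_ladderLimit_joint`; the time
  argument `λ² t` moves) and Chae–Wolf 2017 Thm. 1.3 removes it,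
  `…AsymptoticSelfSimilarityExcluded.no_windowSequence_asymptoticallySelfSimilar_const`
  (convergent scales `lₙ → σ₀ ∈ (1, lam₂)`: `no_windowSequence_asymptoticallySelfSimilar`).

Census sentence after v11: as v10, and moreover the supply cannot degenerate TOWARDS plain
self-similarity at ANY fine scale ratio `λ ∈ (1, λ₁(C₀))` along the ladder ((S5) was the
zero-defect case); only coarse ratios escape.
[cite: ChaeWolf2017RemovingDSS, Theorem 1.3 (arXiv:1610.09464 p. 3)]
[cite: KochNadirashviliSereginSverak2009, Lemma 6.1 (limits of rescaled solutions)] -/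

namespace Summit.NavierStokesRegularity.AngularGalerkinLadderExcludedStrataCensusV11

open Set Filter MeasureTheory Topology Function
open scoped ENNReal
open Literature.Analysis Literature.Analysis.FluidPDE
open Summit.NavierStokesRegularity.FluidComputer
open Summit.NavierStokesRegularity.NavierStokesRegularity.Theses.AngularGalerkinLadder
open Summit.NavierStokesRegularity.AngularGalerkinLadderExcludedStrataCensusV10
open Summit.NavierStokesRegularity.AngularGalerkinLadderAsymptoticSelfSimilarityExcluded

/-- **Census theorem v11: the excluded strata (S0)–(S23) of K2's window sequences.**  As
`excludedStrata_windowSequences_v10` (one more binder `lam₂ > 1`), plus (S23): a plain-DSS defect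
at a fixed fine scale `λ ∈ (1, lam₂)` tending to zero pointwise on the past — for ANY window
`1 < cmin ≤ cmax` and ANY rotations. [cite: ChaeWolf2017RemovingDSS, Theorem 1.3 (arXiv:1610.09464 p. 3)] -/
theorem excludedStrata_windowSequences_v11 :
    ∃ ε₀ : ℝ, 0 < ε₀ ∧ ∀ C₀ : ℝ, ∃ κ α₁ c₁ α₂ c₂ lam₁ β₁ β₂ lam₂ : ℝ,
      1 < κ ∧ 0 < α₁ ∧ 1 < c₁ ∧ 0 < α₂ ∧ 1 < c₂ ∧ 1 < lam₁ ∧ 0 < β₁ ∧ 0 < β₂ ∧ 1 < lam₂ ∧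
      ∀ {cmin cmax δ : ℝ} {L : ℕ → ℕ} {ε c : ℕ → ℝ}
        {R : ℕ → (EuclideanSpace ℝ (Fin 3) ≃ₗᵢ[ℝ] EuclideanSpace ℝ (Fin 3))}
        {u : ℕ → ℝ → EuclideanSpace ℝ (Fin 3) → EuclideanSpace ℝ (Fin 3)}
        {p : ℕ → ℝ → EuclideanSpace ℝ (Fin 3) → ℝ}
        {d : ℕ → ℝ → EuclideanSpace ℝ (Fin 3) → EuclideanSpace ℝ (Fin 3)},
        1 < cmin → 0 < δ → Tendsto ε atTop (𝓝 0) →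
        (∀ n, AngularLadder.IsWindowProfile (L n) C₀ cmin cmax δ (ε n) (c n) (R n) (u n) (p n)
          (d n)) →
        ¬ (C₀ ≤ ε₀ ∨
           (∀ n, ∀ t < 0, IsAxisymmetric (u n t)) ∨
           (∃ q : ℕ, 0 < q ∧ cmax ^ q < κ ∧
              ∀ x, Tendsto (fun n => ((R n) ^ q) x) atTop (𝓝 x)) ∨
           (∃ (q : ℕ) (g : ℕ → (EuclideanSpace ℝ (Fin 3) ≃ₗᵢ[ℝ] EuclideanSpace ℝ (Fin 3)))
              (θ : ℕ → ℝ),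
              0 < q ∧ cmax ^ q < c₁ ∧ (∀ n x, ((R n) ^ q) x = g n (rotZ (θ n) ((g n).symm x))) ∧
              ∀ n, |θ n| ≤ 2 * α₁ * (q * Real.log (c n))) ∨
           (∃ (Θ ℓ : ℝ) (g : ℕ → (EuclideanSpace ℝ (Fin 3) ≃ₗᵢ[ℝ] EuclideanSpace ℝ (Fin 3)))
              (θ : ℕ → ℝ),
              ℓ < Real.log c₂ ∧ (∀ n x, R n x = g n (rotZ (θ n) ((g n).symm x))) ∧
              (∀ n, |θ n| ≤ Θ) ∧ (∀ n, 2 * α₂ * Real.log (c n) ≤ |θ n|) ∧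
              ∀ n, (1 + (θ n / (2 * Real.log (c n))) ^ 2) * Real.log (c n) ≤ ℓ) ∨
           (∃ lam : ℝ, 1 < lam ∧ lam < lam₁ ∧ ∀ n, IsDiscretelySelfSimilar lam (u n)) ∨
           (∀ n, IsSelfSimilar (u n)) ∨
           (∃ (g : ℕ → (EuclideanSpace ℝ (Fin 3) ≃ₗᵢ[ℝ] EuclideanSpace ℝ (Fin 3))) (α : ℕ → ℝ),
              (∀ n (μ : ℝ), 1 < μ → IsRotatedDSS μ
                (((g n).symm.trans (rotZLIE (2 * α n * Real.log μ))).trans (g n)) (u n)) ∧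
              ∀ n, |α n| ≤ β₁ ∨ β₂ ≤ |α n|) ∨
           (∃ M : ℝ≥0∞, M < ⊤ ∧ ∀ n, eLpNorm (u n (-1)) 3 volume ≤ M) ∨
           (∃ M : ℝ≥0∞, M < ⊤ ∧ ∀ n, eLpNorm (u n (-1)) 2 volume ≤ M) ∨
           (∀ η : ℝ, 0 < η → ∃ ρ : ℝ, ∀ n x, ρ ≤ ‖x‖ → ‖x‖ * ‖u n (-1) x‖ ≤ η) ∨
           (∀ n, ∀ t < 0, ∃ e : EuclideanSpace ℝ (Fin 3), ∀ x,
              curl (u n t) x = ‖curl (u n t) x‖ • e) ∨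
           (∀ n, ∃ (d₀ : ℝ) (η : ℝ → ℝ), Tendsto η (𝓝[>] 0) (𝓝 0) ∧
              ∀ s ∈ Ioo (-1 : ℝ) 0, ∀ x y, d₀ < ‖curl (u n s) x‖ → d₀ < ‖curl (u n s) y‖ →
                ‖vorticityDirection (curl (u n s)) x - vorticityDirection (curl (u n s)) y‖ ≤
                  η ‖x - y‖) ∨
           (∃ (n : ℕ) (S : EuclideanSpace ℝ (Fin 3) ≃ₗᵢ[ℝ] EuclideanSpace ℝ (Fin 3))
              (b : EuclideanSpace ℝ (Fin 3)), S b = b ∧ b ≠ 0 ∧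
              ∀ x, ‖u n (-1) (S x + b)‖ = ‖u n (-1) x‖) ∨
           (∃ (n : ℕ) (ρ B : ℝ), 0 < ρ ∧
              ∀ z ∈ parabolicCylinder ρ (0 : ℝ × EuclideanSpace ℝ (Fin 3)), ‖u n z.1 z.2‖ ≤ B) ∨
           (∃ (n : ℕ) (U : EuclideanSpace ℝ (Fin 3) → EuclideanSpace ℝ (Fin 3)),
              Continuous U ∧ ∀ t < 0, u n t = U) ∨
           (∃ (n : ℕ) (e : EuclideanSpace ℝ (Fin 3)), ∀ x, ∃ a : ℝ,
              curl (u n (-1)) x = a • e) ∨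
           (∃ (n : ℕ) (d₀ : ℝ) (η : ℝ → ℝ), Tendsto η (𝓝[>] 0) (𝓝 0) ∧
              ∀ s ∈ Ioo (-1 : ℝ) 0, ∀ x y, d₀ < ‖curl (u n s) x‖ → d₀ < ‖curl (u n s) y‖ →
                min ‖vorticityDirection (curl (u n s)) x - vorticityDirection (curl (u n s)) y‖
                    ‖vorticityDirection (curl (u n s)) x + vorticityDirection (curl (u n s)) y‖ ≤
                  η ‖x - y‖) ∨
           (∃ (n : ℕ) (ρ M : ℝ), 0 < ρ ∧
              ∀ z ∈ parabolicCylinder ρ (0 : ℝ × EuclideanSpace ℝ (Fin 3)),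
                ‖curl (u n z.1) z.2‖ ≤ M) ∨
           (∃ (n : ℕ) (e : EuclideanSpace ℝ (Fin 3)) (ρ M : ℝ), (R n e = e ∨ R n e = -e) ∧
              0 < ρ ∧ ∀ z ∈ parabolicCylinder ρ (0 : ℝ × EuclideanSpace ℝ (Fin 3)),
                ∃ a : ℝ, ‖u n z.1 z.2 - a • e‖ ≤ M) ∨
           (∃ (n : ℕ) (e : EuclideanSpace ℝ (Fin 3)) (ρ M : ℝ), (R n e = e ∨ R n e = -e) ∧
              0 < ρ ∧ ∀ z ∈ parabolicCylinder ρ (0 : ℝ × EuclideanSpace ℝ (Fin 3)),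
                ∃ a : ℝ, ‖curl (u n z.1) z.2 - a • e‖ ≤ M) ∨
           (∃ (n : ℕ) (S : EuclideanSpace ℝ (Fin 3) ≃ₗᵢ[ℝ] EuclideanSpace ℝ (Fin 3))
              (b : EuclideanSpace ℝ (Fin 3)), S b = b ∧ b ≠ 0 ∧
              ∀ x, ‖u n (-1) x‖ ≤ ‖u n (-1) (S x + b)‖) ∨
           (∃ A : ℕ → (EuclideanSpace ℝ (Fin 3) ≃ₗᵢ[ℝ] EuclideanSpace ℝ (Fin 3)),
              ∀ θ, ∀ t < 0, ∀ x,
                Tendsto (fun n => (A n).symm (u n t (A n (rotZ θ x))) -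
                  rotZ θ ((A n).symm (u n t (A n x)))) atTop (𝓝 0)) ∨
           (∃ (S : EuclideanSpace ℝ (Fin 3) ≃ₗᵢ[ℝ] EuclideanSpace ℝ (Fin 3))
              (b : EuclideanSpace ℝ (Fin 3)), S b = b ∧ b ≠ 0 ∧
              ∀ x, Tendsto (fun n => ‖u n (-1) (S x + b)‖ - ‖u n (-1) x‖) atTop (𝓝 0)) ∨
           (∀ s < 0, ∀ t < 0, ∀ x, Tendsto (fun n => u n t x - u n s x) atTop (𝓝 0)) ∨
           (∃ (A : ℕ → (EuclideanSpace ℝ (Fin 3) ≃ₗᵢ[ℝ] EuclideanSpace ℝ (Fin 3))) (α : ℕ → ℝ),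
              Tendsto α atTop (𝓝 0) ∧ (∀ n, α n ≠ 0) ∧ ∀ n, ∀ t < 0, ∀ x,
                (A n).symm (u n t (A n (rotZ (α n) x))) =
                  rotZ (α n) ((A n).symm (u n t (A n x)))) ∨
           (∃ σ : ℕ → ℝ, (∀ n, 1 < σ n) ∧ Tendsto σ atTop (𝓝 1) ∧
              ∀ n, IsDiscretelySelfSimilar (σ n) (u n)) ∨
           (∃ lam : ℝ, 1 < lam ∧ lam < lam₂ ∧ ∀ t < 0, ∀ x,
              Tendsto (fun n => lam • u n (lam ^ 2 * t) (lam • x) - u n t x) atTop (𝓝 0))) := by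
  obtain ⟨ε₀, hε₀, H⟩ := excludedStrata_windowSequences_v10
  refine ⟨ε₀, hε₀, fun C₀ => ?_⟩
  obtain ⟨κ, α₁, c₁, α₂, c₂, lam₁, β₁, β₂, hκ, hα₁, hc₁, hα₂, hc₂, hlam₁, hβ₁, hβ₂, HC⟩ := H C₀
  obtain ⟨lam₂, hlam₂, H₂⟩ := no_windowSequence_asymptoticallySelfSimilar_const C₀
  refine ⟨κ, α₁, c₁, α₂, c₂, lam₁, β₁, β₂, lam₂, hκ, hα₁, hc₁, hα₂, hc₂, hlam₁, hβ₁, hβ₂, hlam₂,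
    fun {cmin cmax δ L ε c R u p d} hcmin hδ hε hW => ?_⟩
  have HC' := HC hcmin hδ hε hW
  simp only [not_or] at HC' ⊢
  obtain ⟨h0, h1, h2, h3, h4, h5, h6, h7, h8, h9, h10, h11, h12, h13, h14, h15, h16, h17, h18, h19,
    h20, h21, h22, h23, h24, h25, h26⟩ := HC'
  exact ⟨h0, h1, h2, h3, h4, h5, h6, h7, h8, h9, h10, h11, h12, h13, h14, h15, h16, h17, h18, h19,
    h20, h21, h22, h23, h24, h25, h26,
    fun ⟨lam, hlam1, hlamc, hdef⟩ => H₂ hlam1 hlamc hcmin hδ hε hW hdef⟩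

end Summit.NavierStokesRegularity.AngularGalerkinLadderExcludedStrataCensusV11
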